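import Mathlib
import Summits.CriticalPhenomena.PercolationContinuityZ3.Theorems.PercNearOneGluingNoHeavyLowerTailFatMinorityBridgeCriterion
import HarnessLib

/-!
# `NoHeavyLowerTail` (stmt-CriticalPhenomena-4575), line fat-minority-linear — the bridge criterion FOR ROWS
# (one-layer observers with arbitrary coins)

Route task `nh-dp-fatminority` (gen 7).  The glued-block theorem `twoSided_bridgeCriterion` applied row by
row: the fired set `B` of coins is a cylinder, pinning it makes `o` a glued block on `B`, and the deleted
graph `Γ' = restrW {o}ᶜ w` is the same for every row, so the anchor `a = argmin_A P_{Γ'}(· ↔ b)`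
(Kozma–Nitzan's Question 9) is row-independent.  No new definitions.
[cite: KozmaNitzan2024, §3.2 Theorems 4–5 (p. 13), Question 9 (p. 36)]
-/

namespace Summit.CriticalPhenomena.PercolationContinuityZ3.Theorems

open MeasureTheory Set
open Literature.Probability.LatticeModels (prodBernoulli prodBernoulli_real_setOf_mem prodBernoulli_real_setOf_notMem)
open Literature.Probability.Percolation
open Literature.Probability.Percolation.KNGoodAux

noncomputable section
open Classical

variable {n : ℕ}

/-- **Bridge criterion for ONE-LAYER OBSERVERS (arbitrary coins, rows).**  `o ∉ A ∋ b`, `a ∈ A`, every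
positive neighbour of `o` a private unit (`X` = units); `Γ' = restrW {o}ᶜ w` (the SAME for every row);
`a` minimises `P_{Γ'}(· ↔ b)` over `A`.  If every nonempty fired set `B ⊆ X` contains a unit `x` with
`P_{Γ'}(a ↔ b, x unattached, B∖{x} attached) + P_{Γ'}(a ↮ b, bridge inside B) ≤ P_{Γ'}(B∖{x} ↔ b, x ↮ b)`,
then `μ(o ↔ A, o ↮ b) ≤ μ(a ↮ b)` (rows are coin cylinders; each row is `twoSided_bridgeCriterion`).
[cite: KozmaNitzan2024, §3.2 Theorems 4–5 (p. 13), Question 9 (p. 36)] -/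
theorem oneLayer_bridgeCriterion (w : Sym2 (Fin n) → unitInterval) (A : Finset (Fin n)) (o a b : Fin n)
    (hoA : o ∉ A) (hb : b ∈ A) (ha : a ∈ A)
    (hX : ∀ y : Fin n, y ≠ o → w s(o, y) ≠ 0 → y ∉ A ∧ ∀ z : Fin n, z ≠ o → z ∉ A → w s(y, z) = 0)
    (hmin : ∀ v ∈ A, (prodBernoulli (restrW ({o}ᶜ : Set (Fin n)) w)).real (openConn a b) ≤
      (prodBernoulli (restrW ({o}ᶜ : Set (Fin n)) w)).real (openConn v b))
    (hH : ∀ B : Finset (Fin n), B ⊆ (Finset.univ.filter fun y : Fin n => y ≠ o ∧ w s(o, y) ≠ 0) →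
      B.Nonempty → ∃ x ∈ B,
        (prodBernoulli (restrW ({o}ᶜ : Set (Fin n)) w)).real
            (openConn a b ∩ {ω | ∀ c ∈ A, s(x, c) ∉ ω} ∩ {ω | ∃ y ∈ B, y ≠ x ∧ ∃ c ∈ A, s(y, c) ∈ ω}) +
          (prodBernoulli (restrW ({o}ᶜ : Set (Fin n)) w)).real
            ((openConn a b)ᶜ ∩ ⋃ u ∈ B, ⋃ v ∈ B.erase u, (openConn a u ∩ openConn v b)) ≤
          (prodBernoulli (restrW ({o}ᶜ : Set (Fin n)) w)).real
            ((⋃ y ∈ B.erase x, openConn y b) ∩ (openConn x b)ᶜ)) :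
    (prodBernoulli w).real ((⋃ c ∈ A, openConn o c) ∩ (openConn o b)ᶜ) ≤
      (prodBernoulli w).real (openConn a b)ᶜ := by
  set X : Finset (Fin n) := Finset.univ.filter fun y : Fin n => y ≠ o ∧ w s(o, y) ≠ 0 with hXdef
  set K : Finset (Sym2 (Fin n)) := X.image fun x => s(o, x) with hKdef
  have hmeas : ∀ E : Set (BondConfig (Fin n)), MeasurableSet E := fun _ => MeasurableSet.of_discrete
  obtain ⟨Bu, hBu⟩ : ∃ Bu : Set (BondConfig (Fin n)), Bu = Set.univ := ⟨Set.univ, rfl⟩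
  have hdet : DeterminedBy Bu (↑K : Set (Sym2 (Fin n))) :=
    (determinedBy_iff _ _).2 fun _ _ _ => by simp [hBu]
  have hint : ∀ E : Set (BondConfig (Fin n)), E ∩ Bu = E := fun E => by rw [hBu, Set.inter_univ]
  have hrows : ∀ E : Set (BondConfig (Fin n)), (prodBernoulli w).real E =
      ∑ P ∈ K.powerset.filter (fun P : Finset (Sym2 (Fin n)) => (↑P : Set (Sym2 (Fin n))) ∈ Bu),
        (prodBernoulli w).real (localCylinder ↑K ↑P) * (prodBernoulli (pinW w ↑K ↑P)).real E := by
    intro E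
    have h := prodBernoulli_real_inter_eq_sum_pinW w K (hmeas E) hdet
    rwa [hint] at h
  rw [hrows, hrows (openConn a b)ᶜ]
  refine Finset.sum_le_sum fun P hP => ?_
  have hPK : P ⊆ K := Finset.mem_powerset.1 (Finset.mem_filter.1 hP).1
  refine mul_le_mul_of_nonneg_left ?_ measureReal_nonneg
  set B : Finset (Fin n) := X.filter fun x => s(o, x) ∈ P with hBdef
  set wP := pinW w (↑K : Set (Sym2 (Fin n))) ↑P with hwP
  have hBX : B ⊆ X := Finset.filter_subset _ _
  have hXunit : ∀ x ∈ X, x ≠ o ∧ w s(o, x) ≠ 0 := fun x hx => (Finset.mem_filter.1 hx).2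
  have hoX : o ∉ X := fun h => (hXunit o h).1 rfl
  have hoB : o ∉ B := fun h => hoX (hBX h)
  have hXA : Disjoint X A := by
    rw [Finset.disjoint_left]
    intro x hx
    exact (hX x (hXunit x hx).1 (hXunit x hx).2).1
  have hBA : Disjoint B A := hXA.mono_left hBX
  have hstar : ∀ x ∈ B, wP s(o, x) = 1 := by
    intro x hx
    obtain ⟨hxX, hxP⟩ := Finset.mem_filter.1 hx
    have hKm : s(o, x) ∈ (↑K : Set (Sym2 (Fin n))) := Finset.mem_coe.2 (Finset.mem_image.2 ⟨x, hxX, rfl⟩)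
    rw [hwP, pinW_apply_of_mem_of_mem w hKm (Finset.mem_coe.2 hxP)]
  have hstar0 : ∀ y : Fin n, y ≠ o → y ∉ B → wP s(o, y) = 0 := by
    intro y hyo hyB
    by_cases hyX : y ∈ X
    · have hKm : s(o, y) ∈ (↑K : Set (Sym2 (Fin n))) := Finset.mem_coe.2 (Finset.mem_image.2 ⟨y, hyX, rfl⟩)
      have hP' : s(o, y) ∉ (↑P : Set (Sym2 (Fin n))) := fun h =>
        hyB (Finset.mem_filter.2 ⟨hyX, Finset.mem_coe.1 h⟩)
      rw [hwP, pinW_apply_of_mem_of_not_mem w hKm hP']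
    · have hw0 : w s(o, y) = 0 := by
        by_contra h
        exact hyX (Finset.mem_filter.2 ⟨Finset.mem_univ _, hyo, h⟩)
      have hKm : s(o, y) ∉ (↑K : Set (Sym2 (Fin n))) := by
        intro h
        obtain ⟨x, hx, hxe⟩ := Finset.mem_image.1 (Finset.mem_coe.1 h)
        have hxo : x ≠ o := (hXunit x hx).1
        rcases Sym2.eq_iff.1 hxe with ⟨_, h2⟩ | ⟨_, h2⟩
        · exact hyX (h2 ▸ hx)
        · exact hxo h2
      rw [hwP, pinW_apply_of_not_mem w _ hKm, hw0]
  have hunit : ∀ x ∈ B, ∀ z : Fin n, z ≠ o → z ∉ A → wP s(x, z) = 0 := by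
    intro x hx z hzo hzA
    have hxX := hBX hx
    have hxo : x ≠ o := (hXunit x hxX).1
    have hKm : s(x, z) ∉ (↑K : Set (Sym2 (Fin n))) := by
      intro h
      obtain ⟨x', hx', hxe⟩ := Finset.mem_image.1 (Finset.mem_coe.1 h)
      rcases Sym2.eq_iff.1 hxe with ⟨h1, _⟩ | ⟨h1, _⟩
      · exact hxo h1.symm
      · exact hzo h1.symm
    rw [hwP, pinW_apply_of_not_mem w _ hKm]
    exact (hX x hxo (hXunit x hxX).2).2 z hzo hzA
  -- the deleted graph of the row is the deleted graph of `w`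
  have hrestr : restrW ({o}ᶜ : Set (Fin n)) wP = restrW ({o}ᶜ : Set (Fin n)) w := by
    funext e
    by_cases he : e ∈ wireSet ({o}ᶜ : Set (Fin n))
    · rw [restrW_apply_of_mem wP he, restrW_apply_of_mem w he, hwP, pinW_apply_of_not_mem w]
      intro heK
      obtain ⟨x, hx, rfl⟩ := Finset.mem_image.1 (Finset.mem_coe.1 heK)
      exact (mk_mem_wireSet_iff.1 he).1 rfl
    · rw [restrW_apply_of_not_mem wP he, restrW_apply_of_not_mem w he]
  by_cases hBne : B.Nonempty
  · obtain ⟨x, hxB, hHx⟩ := hH B hBX hBne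
    have hmin' : ∀ v ∈ A, (prodBernoulli (restrW ({o}ᶜ : Set (Fin n)) wP)).real (openConn a b) ≤
        (prodBernoulli (restrW ({o}ᶜ : Set (Fin n)) wP)).real (openConn v b) := by
      rw [hrestr]; exact hmin
    rw [← hrestr] at hHx
    exact twoSided_bridgeCriterion_bad_le wP B A o x a b hoB hoA hBA hxB hb ha hstar hstar0 hunit hmin' hHx
  · -- no fired unit: `o` is almost surely isolated in the row
    have h0 : ∀ y : Fin n, wP s(o, y) = 0 ∨ y = o := by
      intro y
      by_cases hyo : y = o
      · exact Or.inr hyo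
      · exact Or.inl (hstar0 y hyo fun hyB => hBne ⟨y, hyB⟩)
    have hnull : (prodBernoulli wP).real (⋃ c ∈ A, openConn o c) = 0 := by
      have hsub : (⋃ c ∈ A, (openConn o c : Set (BondConfig (Fin n)))) ⊆
          ⋃ y ∈ (Finset.univ.filter fun y : Fin n => y ≠ o), {ω | s(o, y) ∈ ω} := by
        intro ω hω
        obtain ⟨c, hc, hoc⟩ := Set.mem_iUnion₂.1 hω
        have hco : c ≠ o := fun h => hoA (h ▸ hc)
        obtain ⟨p⟩ := (hoc : (openGraph ω).Reachable o c)
        cases p with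
        | nil => exact absurd rfl hco
        | @cons _ y _ hadj _ =>
          obtain ⟨hoy, hne⟩ := (openGraph_adj ω o y).1 hadj
          exact Set.mem_iUnion₂.2 ⟨y, Finset.mem_filter.2 ⟨Finset.mem_univ _, hne.symm⟩, hoy⟩
      refine le_antisymm ((measureReal_mono hsub (measure_ne_top _ _)).trans
        ((measureReal_biUnion_finset_le _ _).trans (le_of_eq ?_))) measureReal_nonneg
      refine Finset.sum_eq_zero fun y hy => ?_
      have hyo : y ≠ o := (Finset.mem_filter.1 hy).2
      rw [prodBernoulli_real_setOf_mem]
      rcases h0 y with h | h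
      · rw [h]; rfl
      · exact absurd h hyo
    calc (prodBernoulli wP).real ((⋃ c ∈ A, openConn o c) ∩ (openConn o b)ᶜ)
        ≤ (prodBernoulli wP).real (⋃ c ∈ A, openConn o c) :=
          measureReal_mono Set.inter_subset_left (measure_ne_top _ _)
      _ = 0 := hnull
      _ ≤ (prodBernoulli wP).real (openConn a b)ᶜ := measureReal_nonneg

end

end Summit.CriticalPhenomena.PercolationContinuityZ3.Theorems
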